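import Literature.IUT.HodgeTheaters.BirationalDataNonVacuity
import HarnessLib

/-!
# [IUTchI] Example 5.1 (iv): the typed description of the decomposition groups `Π_{𝔭₀}`
# (`BirationalData.DecompIsStabilizer`) — CONDITIONAL INSTANCE FORMS via setwise stabilisers + a CLOSED one
# (FACT-LIST row F-2584)

S. Mochizuki, *Inter-universal Teichmüller theory I*, §5, Example 5.1 (iv) p. 126 (kurims manuscript, May
2020) [claim: Mochizuki2012, status: disputed]: `Π_{𝔭₀} ⊆ π₁(†𝒟^⊛)` is "the elements of `Aut_{†ℱ^⊛}(A)` that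
fix the submonoid `𝒪^⊿_𝔭`, for some system of `𝔭`'s lying over `𝔭₀`".  Typed (abc-iut-L5-t1,
`GlobalFrobenioidsModel.lean`) as the predicate `β.DecompIsStabilizer` on `β : BirationalData G`:
`∀ 𝔭₀, ∃ 𝔭 over 𝔭₀, ∀ g, g ∈ Π_{𝔭₀} ↔ ∀ x, (x ∈ 𝒪^⊿_𝔭 ↔ g • x ∈ 𝒪^⊿_𝔭)`.  PROOF-ONLY companion
(theorems only; no `def`, no `instance`).

Bookkeeping context (abc-iut cell, block F, row INST59C of the LF kernel census): the universal closure of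
F-2584 is REFUTED in tree (`exists_degenerate_not_decompIsStabilizer`: no prime over `𝔭₀`) and the row is
model-witnessed only inside the `∃`-statement `exists_model_decompIsStabilizer` (the GENUINE Galois model
`G_F ↷ F̄ˣ`, valuation rings as primes, built inside a proof).  This file supplies theorems whose
conclusion head is LITERALLY the FACT-LIST declaration:

* (private helper `smul_eq_self_iff_forall_mem_iff`) for a group acting distributively on a commutative group, a
  submonoid `S` is fixed SETWISE by `g` (`g • S = S`, pointwise action) iff `g` "fixes the submonoid" in
  print's element-wise sense `∀ x, x ∈ S ↔ g • x ∈ S` (the `←` direction uses `g⁻¹`);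
* `decompIsStabilizer_iff_exists_eq_stabilizer` — hence the typed predicate says exactly: every `Π_{𝔭₀}`
  is the setwise STABILISER `Stab_G(𝒪^⊿_𝔭)` of `𝒪^⊿_𝔭` for some `𝔭` over `𝔭₀`;
* `decompIsStabilizer_of_decomp_eq_stabilizer` — CONDITIONAL INSTANCE: any datum whose decomposition
  groups are DEFINED as such stabilisers along a section `𝔭₀ ↦ 𝔭(𝔭₀)` of `𝔭 ↦ 𝔭₀` satisfies the row (this
  is how the Galois model of `BirationalDataNonVacuity.lean` is built: `Π_{𝔭₀} := Stab(𝒪_𝔭)` for a chosen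
  valuation ring `𝔭` over `𝔭₀`);
* `decompIsStabilizer_onePrime` — CLOSED INSTANCE over every profinite `G` (no further binders): the
  one-prime datum `𝒪̃^⊛× := 1`, ONE prime `𝔭` over the one `𝔭₀`, `𝒪^⊿_𝔭 := ⊤`, `Π_{𝔭₀} := ⊤ = Stab(⊤)` —
  literally the closure refuter's `_degenerate` record REPAIRED by giving `𝔭₀` a prime over it (DEGENERATE;
  the genuine closed instance is the Galois model `G_F ↷ F̄ˣ`, which the tree builds only inside the proof of
  `exists_model_decompIsStabilizer` and does not name).

HONEST LABELS: statements about OUR typed interface; the conditional instance isolates the (tautological)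
class of data the closure refuter spares; nothing of [IUTchI] is asserted or denied; refuted-closure ≠
refuted-in-print; instantiated ≠ endorsed; typed ≠ proved; nothing here bears on [IUTchIII] Cor. 3.12.
[claim: Mochizuki2012, status: disputed]
-/

namespace Literature.IUT.HodgeTheaters

namespace BirationalData

open scoped Pointwise

universe u

/-- For a group `Γ` acting on a commutative group `M` by group automorphisms and a submonoid `S ≤ M`:
`g` fixes `S` setwise under the pointwise action iff membership in `S` is `g`-invariant in print's sense
("the elements … that fix the submonoid"). [folklore] -/
private theorem smul_eq_self_iff_forall_mem_iff {Γ M : Type*} [Group Γ] [CommGroup M] [MulDistribMulAction Γ M]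
    (g : Γ) (S : Submonoid M) : g • S = S ↔ ∀ x : M, x ∈ S ↔ g • x ∈ S := by
  constructor
  · intro h x
    conv_rhs => rw [← h]
    exact Submonoid.smul_mem_pointwise_smul_iff.symm
  · intro h
    ext y
    rw [Submonoid.mem_pointwise_smul_iff_inv_smul_mem, h (g⁻¹ • y), smul_inv_smul]

variable {G : ProfiniteGrp.{u}} (β : BirationalData G)

/-- **F-2584 reformulated**: the typed description of the decomposition groups holds iff every `Π_{𝔭₀}` IS
the setwise stabiliser in `π₁(†𝒟^⊛)` of the submonoid `𝒪^⊿_𝔭 ⊆ 𝒪̃^⊛×`, for some `𝔭` lying over `𝔭₀`.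
([IUTchI] Ex 5.1 (iv) p.126) [claim: Mochizuki2012, status: disputed] -/
theorem decompIsStabilizer_iff_exists_eq_stabilizer :
    Literature.IUT.HodgeTheaters.BirationalData.DecompIsStabilizer β ↔
      ∀ p0 : β.PrimeIdx0, ∃ p : β.PrimeIdx, β.over p = p0 ∧
        β.decomp p0 = MulAction.stabilizer G (β.Oint p) := by
  rw [decompIsStabilizer_iff]
  refine forall_congr' fun p0 => exists_congr fun p => and_congr_right fun _ => ?_
  rw [SetLike.ext_iff]
  refine forall_congr' fun g => ?_
  rw [MulAction.mem_stabilizer_iff, smul_eq_self_iff_forall_mem_iff]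

/-- **F-2584, CONDITIONAL INSTANCE**: a datum whose decomposition groups are the setwise stabilisers
`Π_{𝔭₀} := Stab(𝒪^⊿_{𝔭(𝔭₀)})` along a section `𝔭₀ ↦ 𝔭(𝔭₀)` of `𝔭 ↦ 𝔭₀` satisfies the typed description of
[IUTchI] Ex 5.1 (iv) — the recipe by which the Galois model `G_F ↷ F̄ˣ` of `BirationalDataNonVacuity.lean`
is built. ([IUTchI] Ex 5.1 (iv) p.126) [claim: Mochizuki2012, status: disputed] -/
theorem decompIsStabilizer_of_decomp_eq_stabilizer (sec : β.PrimeIdx0 → β.PrimeIdx)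
    (hsec : ∀ p0, β.over (sec p0) = p0)
    (hdec : ∀ p0, β.decomp p0 = MulAction.stabilizer G (β.Oint (sec p0))) :
    Literature.IUT.HodgeTheaters.BirationalData.DecompIsStabilizer β :=
  (decompIsStabilizer_iff_exists_eq_stabilizer β).mpr fun p0 => ⟨sec p0, hsec p0, hdec p0⟩

/-- **F-2584, CONDITIONAL INSTANCE (element-wise form)**: the same with the stabiliser condition spelled
in print's element-wise form along the section. ([IUTchI] Ex 5.1 (iv) p.126) [claim: Mochizuki2012, status: disputed] -/
theorem decompIsStabilizer_of_section (sec : β.PrimeIdx0 → β.PrimeIdx)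
    (hsec : ∀ p0, β.over (sec p0) = p0)
    (hdec : ∀ p0 (g : G), g ∈ β.decomp p0 ↔ ∀ x : β.Otilde, x ∈ β.Oint (sec p0) ↔ g • x ∈ β.Oint (sec p0)) :
    Literature.IUT.HodgeTheaters.BirationalData.DecompIsStabilizer β :=
  ⟨fun p0 => ⟨sec p0, hsec p0, hdec p0⟩⟩

/-- **F-2584, CLOSED INSTANCE (DEGENERATE; every profinite `G`, no further binders).**  The one-prime
trivial datum — `𝒪̃^⊛× := 1` (trivial module), one prime `𝔭` lying over the one prime `𝔭₀`, `𝒪^⊿_𝔭 := ⊤`,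
`Π_{𝔭₀} := ⊤` — satisfies the typed description of [IUTchI] Ex 5.1 (iv): `⊤` IS the set of elements fixing
the submonoid `⊤`.  This is the closure refuter's `_degenerate` record (`exists_degenerate_not_decompIsStabilizer`:
NO prime over `𝔭₀`) with its one defect repaired; a statement about OUR interface, nothing about number
fields. ([IUTchI] Ex 5.1 (iv) p.126) [claim: Mochizuki2012, status: disputed] -/
theorem decompIsStabilizer_onePrime (G : ProfiniteGrp.{u}) :
    Literature.IUT.HodgeTheaters.BirationalData.DecompIsStabilizer
      ({ Otilde := PUnit.{u + 1}
         isOpen_stabilizer := fun x => by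
           rw [show (MulAction.stabilizer G x : Set G) = Set.univ from
             Set.eq_univ_of_forall fun _ => Subsingleton.elim _ _]
           exact isOpen_univ
         PrimeIdx := PUnit.{u + 1}
         Oint := fun _ => ⊤
         PrimeIdx0 := PUnit.{u + 1}
         over := id
         decomp := fun _ => ⊤
         IsNonarch := fun _ => True } : BirationalData G) :=
  ⟨fun p0 => ⟨p0, rfl, fun g =>
    iff_of_true (Subgroup.mem_top g) fun x => iff_of_true (Submonoid.mem_top x) (Submonoid.mem_top _)⟩⟩

/-- Conversely every datum satisfying the row carries such a section (choice of the printed "some system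
of `𝔭`'s lying over `𝔭₀`"). ([IUTchI] Ex 5.1 (iv) p.126) [claim: Mochizuki2012, status: disputed] -/
theorem exists_section_of_decompIsStabilizer
    (h : Literature.IUT.HodgeTheaters.BirationalData.DecompIsStabilizer β) :
    ∃ sec : β.PrimeIdx0 → β.PrimeIdx, (∀ p0, β.over (sec p0) = p0) ∧
      ∀ p0, β.decomp p0 = MulAction.stabilizer G (β.Oint (sec p0)) := by
  rw [decompIsStabilizer_iff_exists_eq_stabilizer] at h
  choose sec hsec hdec using h
  exact ⟨sec, hsec, hdec⟩

end BirationalData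

end Literature.IUT.HodgeTheaters
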